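import Literature.MathematicalPhysics.QuantumLattice.HubbardSectorCovariance
import Literature.MathematicalPhysics.QuantumLattice.HubbardSliceSymbolSmoothMomentum
import HarnessLib

/-!
# The centred torus momentum along lattice lines: the no-wrap identity and the wrap alternative near the zone boundary

Topic `MathematicalPhysics/QuantumLattice`.  The polar angle of a torus momentum (`momentumAngle L k⃗`, BGM 2006 §2.5: sectors are indexed by
the angle of the CENTRED representative `torusCentredMomentum L k⃗ ∈ (-π, π]²`, `= 2πk̃/L` with `k̃ = valMinAbs`) is sampled, for the second
SPACE differences of sector symbols (the `L¹` size `b₀` of the sector functions, (2.36aa)), at the three points `k⃗, k⃗ + e_l, k⃗ + 2e_l` of a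
lattice line.  Either the centred coordinate does not wrap — then the three centred momenta lie on the real segment
`c⃗ + t e_l`, `t ∈ {0, 2π/L, 4π/L}` (`torusCentredMomentum_add_smul_single`, `momentumAngle_add_smul_single`) and the mean value theorem
applies — or it wraps, and then all three points lie within `4π/L` of the zone boundary `p_l ≡ π`
(`abs_two_mul_val_sub_le_of_wrap`: `|2·val((k⃗ + m′e_l)_l) − L| ≤ 4` for `m′ ≤ 2`), where the frame band is large and the sector symbols vanish.

* `valMinAbs_add_natCast_of_le` (`(a + m).valMinAbs = a.valMinAbs + m` when `(a.valMinAbs + m)·2 ≤ n`);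
* `torusCentredMomentum_add_smul_single`, `momentumAngle_add_smul_single` (no wrap);
* `val_eq_valMinAbs_of_wrap`, `abs_two_mul_val_sub_le_of_wrap` (wrap ⇒ near the boundary);
* `cos_latticeMomentum_le_of_abs_sub_le` (`|2·val(k_l) − L| ≤ 4 ⇒ cos p_l ≤ −cos(4π/L)`, `8 ≤ L`).

Everything is proved; no definitions, no named facts.

## Sources

G. Benfatto, A. Giuliani, V. Mastropietro, Ann. Henri Poincaré 7 (2006) 809–898, §2.1 (2.1), §2.5 (2.45)–(2.46), (2.36aa)
(`BenfattoGiulianiMastropietro2006`).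
-/

noncomputable section

namespace Literature.MathematicalPhysics.QuantumLattice

open Real Literature.Probability.LatticeModels

variable {L : ℕ} [NeZero L]

/-! ### No wrap: the centred representative moves rigidly -/

omit [NeZero L] in
/-- `(a + m).valMinAbs = a.valMinAbs + m` as long as `(a.valMinAbs + m)·2 ≤ n`. [cite: BenfattoGiulianiMastropietro2006, §2.1 (2.1)] -/
theorem valMinAbs_add_natCast_of_le {n : ℕ} [NeZero n] (a : ZMod n) (m : ℕ) (h : (a.valMinAbs + m) * 2 ≤ n) :
    (a + (m : ZMod n)).valMinAbs = a.valMinAbs + m := by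
  rw [ZMod.valMinAbs_spec]
  refine ⟨?_, ?_, h⟩
  · push_cast
    simp
  · have h1 := (ZMod.valMinAbs_mem_Ioc a).1
    nlinarith

/-- **No wrap**: if `(k̃_l + m)·2 ≤ L` then `c⃗(k⃗ + m e_l) = c⃗(k⃗) + (m·2π/L) e_l`. [cite: BenfattoGiulianiMastropietro2006, §2.5 (2.45)] -/
theorem torusCentredMomentum_add_smul_single (k : TorusSite 2 L) (l : Fin 2) (m : ℕ) (h : ((k l).valMinAbs + m) * 2 ≤ L) :
    torusCentredMomentum L (k + m • (Pi.single l (1 : ZMod L) : TorusSite 2 L)) =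
      torusCentredMomentum L k + (m * (2 * π / L)) • (Pi.single l (1 : ℝ) : Fin 2 → ℝ) := by
  rw [torusCentredMomentum_eq_valMinAbs, torusCentredMomentum_eq_valMinAbs]
  funext j
  by_cases hj : j = l
  · subst hj
    simp only [Pi.add_apply, Pi.smul_apply, Pi.single_eq_same, smul_eq_mul, mul_one]
    rw [nsmul_eq_mul, mul_one, valMinAbs_add_natCast_of_le (k j) m h]
    push_cast
    ring
  · simp only [Pi.add_apply, Pi.smul_apply, Pi.single_eq_of_ne hj, smul_eq_mul, smul_zero, mul_zero, add_zero]

/-- **No wrap, angles**: `θ(k⃗ + m e_l) = polarAngle(c⃗(k⃗) + (m·2π/L) e_l)`. [cite: BenfattoGiulianiMastropietro2006, §2.5 (2.45)] -/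
theorem momentumAngle_add_smul_single (k : TorusSite 2 L) (l : Fin 2) (m : ℕ) (h : ((k l).valMinAbs + m) * 2 ≤ L) :
    momentumAngle L (k + m • (Pi.single l (1 : ZMod L) : TorusSite 2 L)) =
      polarAngle (torusCentredMomentum L k + (m * (2 * π / L)) • (Pi.single l (1 : ℝ) : Fin 2 → ℝ)) := by
  rw [momentumAngle, torusCentredMomentum_add_smul_single k l m h]

/-! ### Wrap: all three points are within two steps of the zone boundary -/

omit [NeZero L] in
/-- If `L < (k̃_l + m)·2` with `m ≤ 2` and `4 < L`, then `k̃_l ≥ 0`, so `val(k_l) = k̃_l` and `L − 4 < 2·val(k_l) ≤ L`.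
[cite: BenfattoGiulianiMastropietro2006, §2.1 (2.1)] -/
theorem val_eq_valMinAbs_of_wrap [NeZero L] (a : ZMod L) {m : ℕ} (hm : m ≤ 2) (hL : 4 < L) (h : (L : ℤ) < (a.valMinAbs + m) * 2) :
    (a.val : ℤ) = a.valMinAbs ∧ (L : ℤ) - 4 < 2 * (a.val : ℤ) ∧ 2 * (a.val : ℤ) ≤ L := by
  have hm' : (m : ℤ) ≤ 2 := by exact_mod_cast hm
  have hpos : 0 ≤ a.valMinAbs := by linarith
  have hval : a.val ≤ L / 2 := (ZMod.valMinAbs_nonneg_iff a).1 hpos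
  have heq : a.valMinAbs = (a.val : ℤ) := by
    rw [ZMod.valMinAbs_def_pos, if_pos hval]
  have h2 := (ZMod.valMinAbs_mem_Ioc a).2
  refine ⟨heq.symm, ?_, ?_⟩
  · rw [← heq]; linarith
  · rw [← heq]; linarith

/-- **Wrap ⇒ near the boundary**: if the centred coordinate wraps within two steps (`L < (k̃_l + m)·2`, `m ≤ 2`, `8 < L`), then for every
`m′ ≤ 2` the index of `(k⃗ + m′e_l)_l` satisfies `|2·val − L| ≤ 4`. [cite: BenfattoGiulianiMastropietro2006, §2.1 (2.1)] -/
theorem abs_two_mul_val_sub_le_of_wrap (k : TorusSite 2 L) (l : Fin 2) {m : ℕ} (hm : m ≤ 2) (hL : 8 < L)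
    (h : (L : ℤ) < ((k l).valMinAbs + m) * 2) (m' : ℕ) (hm' : m' ≤ 2) :
    |2 * (((k + m' • (Pi.single l (1 : ZMod L) : TorusSite 2 L)) l).val : ℤ) - L| ≤ 4 := by
  obtain ⟨_, hlo, hhi⟩ := val_eq_valMinAbs_of_wrap (k l) hm (by omega) h
  have hv : ((k + m' • (Pi.single l (1 : ZMod L) : TorusSite 2 L)) l).val = (k l).val + m' := by
    rw [nsmul_single_one, Pi.add_apply, Pi.single_eq_same, ZMod.val_add, ZMod.val_natCast, Nat.mod_eq_of_lt (a := m') (by omega),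
      Nat.mod_eq_of_lt]
    have : 2 * ((k l).val : ℤ) ≤ L := hhi
    omega
  rw [hv, abs_le]
  push_cast
  constructor <;> linarith [show ((m' : ℤ)) ≤ 2 from by exact_mod_cast hm', show (0 : ℤ) ≤ m' from by positivity]

omit [NeZero L] in
/-- **Near the boundary the cosine is close to `−1`**: `|2·val(k_l) − L| ≤ 4` and `8 ≤ L` give `cos p_l ≤ −cos(4π/L)` for the lattice momentum
`p_l = 2π·val(k_l)/L`. [cite: BenfattoGiulianiMastropietro2006, §2.1 (2.1)] -/
theorem cos_latticeMomentum_le_of_abs_sub_le (k : TorusSite 2 L) (l : Fin 2) (hL : 8 ≤ L)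
    (h : |2 * (((k l).val : ℤ)) - L| ≤ 4) : Real.cos (latticeMomentum L k l) ≤ -Real.cos (4 * π / L) := by
  have hL0 : (0 : ℝ) < L := by exact_mod_cast (show 0 < L by omega)
  -- `p_l = π + x` with `|x| = π|2 val − L|/L ≤ 4π/L ≤ π/2`
  set x : ℝ := π * ((2 * ((k l).val : ℝ) - L) / L) with hx
  have hp : latticeMomentum L k l = π + x := by
    simp only [latticeMomentum, hx]
    field_simp
    ring
  have habs : |x| ≤ 4 * π / L := by
    have h' : |(2 * ((k l).val : ℝ) - L)| ≤ 4 := by exact_mod_cast h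
    rw [hx, abs_mul, abs_of_pos pi_pos, abs_div, abs_of_pos hL0]
    calc π * (|2 * ((k l).val : ℝ) - L| / L) ≤ π * (4 / L) := by gcongr
      _ = 4 * π / L := by ring
  have h4 : 4 * π / L ≤ π / 2 := by
    rw [div_le_div_iff₀ hL0 (by norm_num : (0:ℝ) < 2)]
    have : (8 : ℝ) ≤ L := by exact_mod_cast hL
    nlinarith [pi_pos]
  rw [hp, Real.cos_add, Real.cos_pi, Real.sin_pi, neg_one_mul, zero_mul, sub_zero, neg_le_neg_iff, ← Real.cos_abs x]
  exact Real.cos_le_cos_of_nonneg_of_le_pi (abs_nonneg x) (h4.trans (by linarith [pi_pos])) habs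

end Literature.MathematicalPhysics.QuantumLattice

end
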